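import Literature.AnabelianGeometry.AbsoluteAnabelian.GaloisCyclotomeRestrictionCompat
import Literature.AnabelianGeometry.AbsoluteAnabelian.GaloisCyclotomeRestrictionIndex
import Literature.NumberTheory.GaloisRepresentations.LocalGaloisGroupProofs
import Literature.NumberTheory.GaloisRepresentations.LocalGaloisGroupInertiaProofs
import HarnessLib

/-!
# THE characterised identifications `μ_{ℚ/ℤ}(G_k) ≅ μ(k̄)` are restriction-compatible along every finite
# extension of MLFs ([AbsAnab] Prop. 1.2.1 (vi)/(vii); [AbsTopIII] Cor. 1.10 (i), Rmk. 1.10.1 (iii))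

abc-iut cell, layer L4, row «COR110ib-OPEN» file F4 (abc-iut-L4-t11): the export consumed by abc-iut-L4-d3's
`AbsTopIII.cor_1_10_i_a_resNatural_of_compatible` / `cor_1_10_i_b_resNatural_of_compatible` (their single
hypothesis `hres`).  For THE data `(exists_torsionReciprocityData_levelChar k).choose` of the natural family of
[AbsTopIII] Cor. 1.10 (i) (abc-iut-L6-t11 / abc-iut-L4-d3) and every finite extension `k′/k` of MLFs of
characteristic `0` — with L4-d3's instance-free binders: ANY local-field structure on `k′` and any
`k`-algebra structure, the valuation of `k′` then automatically extending that of `k`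
(`valuativeExtension_of_cast_residueFieldCard_eq_zero`, uniqueness of complete valuations):

* `levelChar_equiv_restrict_compat` — shape (H): `φ_{k′} (μ_{ℚ/ℤ}(res)⁻¹ z) = ι (φ_k z)` on values in `k̄′`
  (`Cor110Open.equiv_restrict_compat`, file F3);
* `levelChar_equiv_eq_inducedCyclotomeEquiv` — shape (P): `φ_{k′} = inducedCyclotomeEquiv k k′ φ_k`
  pointwise (abc-iut-w5-d201's induced identification).

Proof-only; universe `0`.  HONEST FRAMING: classical local class field theory; nothing here bears on
[IUTchIII] Cor. 3.12.
-/

noncomputable section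

open Field ValuativeRel

namespace Literature.AnabelianGeometry.AbsoluteAnabelian

open Literature.NumberTheory.GaloisRepresentations
open Literature.NumberTheory.GaloisRepresentations.IsNonarchimedeanLocalField

namespace Cor110Open

variable (k : Type) [Field k] [ValuativeRel k] [TopologicalSpace k] [IsNonarchimedeanLocalField k]
  [CharZero k] (k' : Type) [Field k'] [ValuativeRel k'] [TopologicalSpace k'] [IsNonarchimedeanLocalField k']
  [CharZero k'] [Algebra k k'] [FiniteDimensional k k']

/-- **Shape (H).**  For every finite extension `k′/k` of MLFs (characteristic `0`; any local-field structure on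
`k′`, any `k`-algebra structure) and THE characterised data `D_k`, `D_{k′}`
(`exists_torsionReciprocityData_levelChar`): `D_{k′}.equiv (μ_{ℚ/ℤ}(res)⁻¹ z) = ι (D_k.equiv z)` in `k̄′` for
all `z ∈ μ_{ℚ/ℤ}(G_k)` — the `hcompat` binder of `reciprocityIso_galCyclotomeRes`.
[cite: MochizukiAbsAnab2004, Prop 1.2.1 (vi) p.10] -/
theorem levelChar_equiv_restrict_compat (z : muQZ (absoluteGaloisGroup k)) :
    (((Additive.toMul ((exists_torsionReciprocityData_levelChar k').choose.equiv
        ((muQZ.mapOfOpenEmbedding (absGaloisRestrict k k')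
        (absGaloisRestrict_injective k k') (isOpen_range_absGaloisRestrict k k')).symm z)) :
        CommGroup.torsion (AlgebraicClosure k')ˣ) : (AlgebraicClosure k')ˣ) : AlgebraicClosure k') =
      absClosureEmbedding k k' ((((Additive.toMul ((exists_torsionReciprocityData_levelChar k).choose.equiv
        z)) : CommGroup.torsion (AlgebraicClosure k)ˣ) : (AlgebraicClosure k)ˣ) : AlgebraicClosure k) := by
  haveI : ValuativeExtension k k' :=
    valuativeExtension_of_cast_residueFieldCard_eq_zero cast_residueFieldCard_eq_zero_of_algebra
  exact equiv_restrict_compat k k' (exists_torsionReciprocityData_levelChar k).choose_spec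
    (exists_torsionReciprocityData_levelChar k').choose_spec z

/-- **Shape (P): THE characterised identifications are restriction-compatible** — for every finite extension
`k′/k` of MLFs (characteristic `0`), `D_{k′}.equiv = inducedCyclotomeEquiv k k′ D_k.equiv` pointwise, i.e. THE
identification of `k′` is the one INDUCED from that of `k` along `res : G_{k′} ↪ G_k` and `ι : k̄ ≅ k̄′`
([AbsAnab] p. 11 «by considering the Verlagerung»).  This is verbatim the hypothesis `hres` of
abc-iut-L4-d3's `AbsTopIII.cor_1_10_i_a_resNatural_of_compatible` and `cor_1_10_i_b_resNatural_of_compatible`.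
[cite: MochizukiAbsAnab2004, Prop 1.2.1 (vi) p.10] -/
theorem levelChar_equiv_eq_inducedCyclotomeEquiv (x : muQZ (absoluteGaloisGroup k')) :
    (exists_torsionReciprocityData_levelChar k').choose.equiv x =
      inducedCyclotomeEquiv k k' (exists_torsionReciprocityData_levelChar k).choose.equiv x := by
  have h := levelChar_equiv_restrict_compat k k' (muQZ.mapOfOpenEmbedding (absGaloisRestrict k k')
    (absGaloisRestrict_injective k k') (isOpen_range_absGaloisRestrict k k') x)
  rw [AddEquiv.symm_apply_apply] at h
  apply Additive.toMul.injective
  apply Subtype.ext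
  apply Units.ext
  rw [h, inducedCyclotomeEquiv_apply, coe_toMul_torsionUnitsTransport]

end Cor110Open

end Literature.AnabelianGeometry.AbsoluteAnabelian
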